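import Summits.BirchSwinnertonDyer.BirchSwinnertonDyer.Theorems.PrintCFramBottomClassIndexLawFiveLeHeegnerFieldSupplySixPrimes
import Summits.BirchSwinnertonDyer.BirchSwinnertonDyer.Theorems.PrintCFramBottomClassIndexLawFiveLeEisensteinEndStateV19
import Summits.BirchSwinnertonDyer.BirchSwinnertonDyer.Theorems.PrintCFramBottomClassIndexLawFiveLeEisensteinEndStateV19Currencies
import Summits.BirchSwinnertonDyer.BirchSwinnertonDyer.Theorems.PrintCFramBottomClassIndexLawFiveLeEisensteinEndStateV19Binders
import HarnessLib

/-!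
# Crux `PrintCFram.BottomClassIndexLawFiveLe` (stmt-BirchSwinnertonDyer-20372), line `eisenstein-resource-bdp-line` (registry v19):
# END STATE v19, SUPPLY FORMS — the crux BY NAME ⟸ four refereed print facts ∧ Kriz–Li Thm. 1.20 ∧ B1 ∧ the curve-free supply statement `(P)`,
# resp. ∧ its Heegner-family form at the six leaf primes `(P⁶_fam)`
# (cell `bsd-print-cfram`, width seat `bsd-line-cfram-p1-w8` g4; THEOREMS ONLY, `--supports` 20372; BSD is not proved by any of this)

HONEST FRAMING. One composition, no new mathematics: LEAD g11's END STATE v19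
(`EisensteinEndStateV19.bottomClassIndexLawFiveLe_of_prints4_of_krizLi_of_classFactor_of_cover`: crux ⟸ prints4 ∧ KL ∧ B1 ∧ C) with
the Stub C slot fed by `HeegnerFieldSupply.stubC_of_splitPrimes_bernoulliUnit` (`(P) ⟹ C`, file `…HeegnerFieldSupplySocket`), resp. by
`HeegnerFieldSupply.stubC_of_heegnerFamily_bernoulliUnit_six` (`(P⁶_fam) ⟹ C`, file `…HeegnerFieldSupplySixPrimes`). So on this line
the crux is conditional on the four citations, Kriz–Li Thm. 1.20, the arithmetic research statement B1 (`stub_bsdp_of_classFactor`), and ONE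
statement `(P)` of `GL₁/ℚ` number theory with no elliptic curve in it — equivalently (§2) one `p`-adic unit condition on a generalized
Bernoulli number indexed by `(n, t)`, `n ∈ pm·ℤ`, `gcd(t, 2pm) = 1`, at the six leaf primes `p ∈ {7, 11, 19, 43, 67, 163}`. Kept in its own file because it imports the Theses cone (the END STATE
concludes the crux by name). beyond-print theorem: NO. References: [KrizLi2019] Thm. 1.20, §8; registry v19.
-/

set_option autoImplicit false
-- summit-side namespace `Summit.BirchSwinnertonDyer.BirchSwinnertonDyer.…` (single-conjunct summit, D-0017 layout)
set_option linter.dupNamespace false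

noncomputable section

open scoped Classical
open NumberField WeierstrassCurve DirichletCharacter Literature.NumberTheory.LFunctions
  Literature.NumberTheory.EllipticCurves Literature.NumberTheory.EllipticCurves.KrizLi2019
  Literature.NumberTheory.EllipticCurves.Rank1Residual
open Literature.NumberTheory.Congruences

namespace Summit.BirchSwinnertonDyer.BirchSwinnertonDyer.Theorems.PrintCFram.HeegnerFieldSupply

open Summit.BirchSwinnertonDyer.BirchSwinnertonDyer.Theorems.PrintCFram
open Summit.BirchSwinnertonDyer.Rank1Residual.X12.O11

/-! ## §1 END STATE v19 with Stub C replaced by `(P)` -/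

/-- **END STATE v19, supply form: the crux `BottomClassIndexLawFiveLe` BY NAME ⟸ the four refereed print facts ∧ Kriz–Li Thm. 1.20 ∧
B1 (`stub_bsdp_of_classFactor`, verbatim) ∧ the curve-free supply statement `(P)`.** LEAD g11's
`EisensteinEndStateV19.bottomClassIndexLawFiveLe_of_prints4_of_krizLi_of_classFactor_of_cover` with its Stub C slot fed by
`stubC_of_splitPrimes_bernoulliUnit`. Conditional on the named facts it lists; BSD is not proved by any of this.
[cite: KrizLi2019, Thm. 1.20 (pp. 7–8) and §8 (pp. 49–52)] [cite: Hsieh2014, Thm. A] [cite: BurungaleFlach2024, Cor. 2] -/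
theorem bottomClassIndexLawFiveLe_of_prints4_of_krizLi_of_classFactor_of_splitPrimes
    (hprints4 :
    Hsieh2014.thmA_exists_isHsiehLFunction_unrPeriod_anyLevel ∧
    LiuZhangZhang2018.thm151_thm153_modularCurve_heegnerVector_additive ∧
    Summit.BirchSwinnertonDyer.BirchSwinnertonDyer.Theses.UniversalToricDescent.ToricPublishedInputs ∧
    bsdTriple_of_hasCM_of_L_one_ne_zero)
    (hKL : KrizLi2019.thm120_padicLogHeegner_unit_of_bernoulli)
    (hB1 :
    ∀ (W : WeierstrassCurve ℚ) [W.IsElliptic] [W.IsGloballyMinimal] (p : ℕ) [Fact p.Prime],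
      W.HasCM → CMRamified W p → 5 ≤ p → W.analyticRank = 1 →
      ∀ (f : ℕ) [NeZero f] (ψ : DirichletCharacter ℚ_[p] f) (ω : DirichletCharacter ℚ_[p] p),
        ψ.Odd → IsTeichmullerCharacter ω →
        (∀ ℓ : ℕ, ℓ.Prime → ¬ (ℓ ∣ p * W.conductorNorm ℤ) →
          ‖((W.LFunction ℓ : ℤ) : ℚ_[p]) - (ψ (ℓ : ZMod f) + ψ⁻¹ (ℓ : ZMod f) * ω (ℓ : ZMod p))‖ < 1) →
        ‖bernoulliOnePrim ψ⁻¹‖ ≤ (p : ℝ)⁻¹ →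
        BSDp W p)
    (hP : ∀ (p : ℕ) [Fact p.Prime] (m : ℕ) [NeZero m] (χ : DirichletCharacter ℚ_[p] m) (k : ℕ),
      5 ≤ p → m.Coprime p → χ.IsPrimitive → χ.IsQuadratic → (k = (p + 1) / 4 ∨ k = (3 * p - 1) / 4) →
      2 ≤ k → k ≤ p - 2 → χ (-1) * (-1) ^ k = -1 →
      ¬ ‖((p - k : ℕ) : ℚ_[p])⁻¹ * generalizedBernoulli (p - k) χ‖ ≤ (p : ℝ)⁻¹ →
      ∃ (K : Type) (_ : Field K) (_ : NumberField K) (εK : DirichletCharacter ℚ_[p] (NumberField.discr K).natAbs),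
        IsImaginaryQuadratic K ∧
        (∀ q : ℕ, q.Prime → q ∣ p * m → ((Ideal.span {(q : ℤ)}).primesOver (𝓞 K)).ncard = 2) ∧
        Odd (NumberField.discr K) ∧ NumberField.discr K < -4 ∧ IsKroneckerCharacterOf K εK ∧
        ¬ ‖(k : ℚ_[p])⁻¹ * @generalizedBernoulli ℚ_[p] _ _
            (changeLevel (dvd_mul_right m (NumberField.discr K).natAbs) χ *
              changeLevel (dvd_mul_left (NumberField.discr K).natAbs m) εK).conductor ⟨conductor_ne_zero _⟩ k
            (changeLevel (dvd_mul_right m (NumberField.discr K).natAbs) χ *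
              changeLevel (dvd_mul_left (NumberField.discr K).natAbs m) εK).primitiveCharacter‖ ≤ (p : ℝ)⁻¹) :
    Summit.BirchSwinnertonDyer.BirchSwinnertonDyer.Theses.PrintCFram.BottomClassIndexLawFiveLe :=
  EisensteinEndStateV19.bottomClassIndexLawFiveLe_of_prints4_of_krizLi_of_classFactor_of_cover hprints4 hKL hB1
    (stubC_of_splitPrimes_bernoulliUnit hP)

/-! ## §2 END STATE v19 with Stub C replaced by `(P⁶_fam)` -/

/-- **END STATE v19, Heegner-family supply form at the six leaf primes: the crux `BottomClassIndexLawFiveLe` BY NAME ⟸ the four refereed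
print facts ∧ Kriz–Li Thm. 1.20 ∧ B1 ∧ `(P⁶_fam)`** — `(P⁶_fam)`: for `p ∈ {7, 11, 19, 43, 67, 163}`, `m ⊥ p`, `χ` primitive quadratic mod `m`,
`k ∈ {(p+1)/4, (3p−1)/4}` with `χ(−1)(−1)^k = −1`, unit class factor ⟹ some `n ∈ pm·ℤ`, `t` prime to `2pm` with `t² < 4n`, a quadratic `K` with
`d_K·F² = t² − 4n`, `d_K ≠ −3`, a Kronecker `ε_K`, and `p ∤ B_{k,(χ·ε_K)~}/k`. LEAD g11's END STATE with the C slot fed by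
`stubC_of_heegnerFamily_bernoulliUnit_six`. Conditional on the named facts it lists; BSD is not proved by any of this.
[cite: KrizLi2019, Thm. 1.20 (pp. 7–8) and §8 (pp. 49–52)] [cite: Cox2013, §7.A (7.2)–(7.3) and Prop. 5.16] -/
theorem bottomClassIndexLawFiveLe_of_prints4_of_krizLi_of_classFactor_of_heegnerFamily_six
    (hprints4 :
    Hsieh2014.thmA_exists_isHsiehLFunction_unrPeriod_anyLevel ∧
    LiuZhangZhang2018.thm151_thm153_modularCurve_heegnerVector_additive ∧
    Summit.BirchSwinnertonDyer.BirchSwinnertonDyer.Theses.UniversalToricDescent.ToricPublishedInputs ∧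
    bsdTriple_of_hasCM_of_L_one_ne_zero)
    (hKL : KrizLi2019.thm120_padicLogHeegner_unit_of_bernoulli)
    (hB1 :
    ∀ (W : WeierstrassCurve ℚ) [W.IsElliptic] [W.IsGloballyMinimal] (p : ℕ) [Fact p.Prime],
      W.HasCM → CMRamified W p → 5 ≤ p → W.analyticRank = 1 →
      ∀ (f : ℕ) [NeZero f] (ψ : DirichletCharacter ℚ_[p] f) (ω : DirichletCharacter ℚ_[p] p),
        ψ.Odd → IsTeichmullerCharacter ω →
        (∀ ℓ : ℕ, ℓ.Prime → ¬ (ℓ ∣ p * W.conductorNorm ℤ) →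
          ‖((W.LFunction ℓ : ℤ) : ℚ_[p]) - (ψ (ℓ : ZMod f) + ψ⁻¹ (ℓ : ZMod f) * ω (ℓ : ZMod p))‖ < 1) →
        ‖bernoulliOnePrim ψ⁻¹‖ ≤ (p : ℝ)⁻¹ →
        BSDp W p)
    (hF : ∀ (p : ℕ) [Fact p.Prime] (m : ℕ) [NeZero m] (χ : DirichletCharacter ℚ_[p] m) (k : ℕ),
      (p = 7 ∨ p = 11 ∨ p = 19 ∨ p = 43 ∨ p = 67 ∨ p = 163) →
      m.Coprime p → χ.IsPrimitive → χ.IsQuadratic → (k = (p + 1) / 4 ∨ k = (3 * p - 1) / 4) →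
      2 ≤ k → k ≤ p - 2 → χ (-1) * (-1) ^ k = -1 →
      ¬ ‖((p - k : ℕ) : ℚ_[p])⁻¹ * generalizedBernoulli (p - k) χ‖ ≤ (p : ℝ)⁻¹ →
      ∃ (n t F : ℤ) (K : Type) (_ : Field K) (_ : NumberField K)
        (εK : DirichletCharacter ℚ_[p] (NumberField.discr K).natAbs),
        Module.finrank ℚ K = 2 ∧ NumberField.discr K * F ^ 2 = t ^ 2 - 4 * n ∧ t ^ 2 < 4 * n ∧
        ((p * m : ℕ) : ℤ) ∣ n ∧ IsCoprime t ((2 * p * m : ℕ) : ℤ) ∧ NumberField.discr K ≠ -3 ∧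
        IsKroneckerCharacterOf K εK ∧
        ¬ ‖(k : ℚ_[p])⁻¹ * @generalizedBernoulli ℚ_[p] _ _
            (changeLevel (dvd_mul_right m (NumberField.discr K).natAbs) χ *
              changeLevel (dvd_mul_left (NumberField.discr K).natAbs m) εK).conductor ⟨conductor_ne_zero _⟩ k
            (changeLevel (dvd_mul_right m (NumberField.discr K).natAbs) χ *
              changeLevel (dvd_mul_left (NumberField.discr K).natAbs m) εK).primitiveCharacter‖ ≤ (p : ℝ)⁻¹) :
    Summit.BirchSwinnertonDyer.BirchSwinnertonDyer.Theses.PrintCFram.BottomClassIndexLawFiveLe :=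
  EisensteinEndStateV19.bottomClassIndexLawFiveLe_of_prints4_of_krizLi_of_classFactor_of_cover hprints4 hKL hB1
    (stubC_of_heegnerFamily_bernoulliUnit_six hF)

/-! ## §3 END STATE v19 in Bernoulli currency for B1 and Heegner-family currency for C -/

/-- **END STATE v19, ALL RESEARCH HYPOTHESES IN BERNOULLI CURRENCY: the crux BY NAME ⟸ prints4 ∧ Kriz–Li Thm. 1.20 ∧ B1_Bern ∧ `(P⁶_fam)`.**
B1_Bern = LEAD g11's generalized-Bernoulli form of B1 (`BSD_p` for rank-one class members whose class factor `B_{p−k,χ_e}/(p−k)` is divisible by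
`p`); `(P⁶_fam)` = this seat's curve-free Heegner-family supply statement at the six leaf primes. LEAD g11's
`EisensteinEndStateV19Currencies.bottomClassIndexLawFiveLe_of_prints4_of_krizLi_of_bernoulliClassFactor_of_bernoulliCover` with its C_Bern slot
fed by `KummerDictionary.stubC_iff_bernoulli.mp (stubC_of_heegnerFamily_bernoulliUnit_six hF)`. Conditional on the named facts it lists;
BSD is not proved by any of this. [cite: KrizLi2019, Thm. 1.20 (pp. 7–8) and §8 (pp. 49–52)] [cite: Washington1997, Thm. 5.11 and Cor. 5.13] -/
theorem bottomClassIndexLawFiveLe_of_prints4_of_krizLi_of_bernoulliClassFactor_of_heegnerFamily_six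
    (hprints4 :
    Hsieh2014.thmA_exists_isHsiehLFunction_unrPeriod_anyLevel ∧
    LiuZhangZhang2018.thm151_thm153_modularCurve_heegnerVector_additive ∧
    Summit.BirchSwinnertonDyer.BirchSwinnertonDyer.Theses.UniversalToricDescent.ToricPublishedInputs ∧
    bsdTriple_of_hasCM_of_L_one_ne_zero)
    (hKL : KrizLi2019.thm120_padicLogHeegner_unit_of_bernoulli)
    (hB1 :
    ∀ (W : WeierstrassCurve ℚ) [W.IsElliptic] [W.IsGloballyMinimal] (p : ℕ) [Fact p.Prime],
      W.HasCM → CMRamified W p → 5 ≤ p → W.analyticRank = 1 →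
      ∀ (m : ℕ) [NeZero m] (χ : DirichletCharacter ℚ_[p] m) (ε : ℕ → ℤ) (k : ℕ),
        m.Coprime p → χ.IsPrimitive → χ.IsQuadratic → (∀ ℓ : ℕ, ℓ.Prime → ℓ ≠ p → χ (ℓ : ZMod m) = (ε ℓ : ℚ_[p])) →
        2 ≤ k → k ≤ p - 2 → χ (-1) * (-1) ^ k = -1 →
        (∀ ℓ : ℕ, ℓ.Prime → ℓ ≠ p →
          ((W.LFunction ℓ : ℤ) : ZMod p) = (ε ℓ : ZMod p) * ((ℓ : ZMod p) ^ k + (ℓ : ZMod p) ^ (p - k))) →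
        (∀ ℓ : ℕ, (hℓ : ℓ.Prime) → ℓ ≠ p → ¬ ℓ ∣ m → (haveI := Fact.mk hℓ; W.HasGoodReductionAtPrime ℓ)) →
        ‖((p - k : ℕ) : ℚ_[p])⁻¹ * generalizedBernoulli (p - k) χ‖ ≤ (p : ℝ)⁻¹ →
        BSDp W p)
    (hF : ∀ (p : ℕ) [Fact p.Prime] (m : ℕ) [NeZero m] (χ : DirichletCharacter ℚ_[p] m) (k : ℕ),
      (p = 7 ∨ p = 11 ∨ p = 19 ∨ p = 43 ∨ p = 67 ∨ p = 163) →
      m.Coprime p → χ.IsPrimitive → χ.IsQuadratic → (k = (p + 1) / 4 ∨ k = (3 * p - 1) / 4) →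
      2 ≤ k → k ≤ p - 2 → χ (-1) * (-1) ^ k = -1 →
      ¬ ‖((p - k : ℕ) : ℚ_[p])⁻¹ * generalizedBernoulli (p - k) χ‖ ≤ (p : ℝ)⁻¹ →
      ∃ (n t F : ℤ) (K : Type) (_ : Field K) (_ : NumberField K)
        (εK : DirichletCharacter ℚ_[p] (NumberField.discr K).natAbs),
        Module.finrank ℚ K = 2 ∧ NumberField.discr K * F ^ 2 = t ^ 2 - 4 * n ∧ t ^ 2 < 4 * n ∧
        ((p * m : ℕ) : ℤ) ∣ n ∧ IsCoprime t ((2 * p * m : ℕ) : ℤ) ∧ NumberField.discr K ≠ -3 ∧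
        IsKroneckerCharacterOf K εK ∧
        ¬ ‖(k : ℚ_[p])⁻¹ * @generalizedBernoulli ℚ_[p] _ _
            (changeLevel (dvd_mul_right m (NumberField.discr K).natAbs) χ *
              changeLevel (dvd_mul_left (NumberField.discr K).natAbs m) εK).conductor ⟨conductor_ne_zero _⟩ k
            (changeLevel (dvd_mul_right m (NumberField.discr K).natAbs) χ *
              changeLevel (dvd_mul_left (NumberField.discr K).natAbs m) εK).primitiveCharacter‖ ≤ (p : ℝ)⁻¹) :
    Summit.BirchSwinnertonDyer.BirchSwinnertonDyer.Theses.PrintCFram.BottomClassIndexLawFiveLe :=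
  EisensteinEndStateV19Currencies.bottomClassIndexLawFiveLe_of_prints4_of_krizLi_of_bernoulliClassFactor_of_bernoulliCover hprints4 hKL hB1
    (KummerDictionary.stubC_iff_bernoulli.mp (stubC_of_heegnerFamily_bernoulliUnit_six hF))

/-! ## §4 (append) END STATE v19 in the crux's own binders for B1 and Heegner-family currency for C -/

/-- **END STATE v19, BINDERS × HEEGNER FAMILY: the crux `BottomClassIndexLawFiveLe` BY NAME ⟸ prints4 ∧ Mazur–Wiles Thm. 2 ∧ Kriz–Li Thm. 1.20 ∧
`(P⁶_fam)` ∧ B1-level ∧ B1-sha.** LEAD g11's `EisensteinEndStateV19Binders.bottomClassIndexLawFiveLe_of_prints4_of_mazurWiles_of_krizLi_of_cover_of_level_of_sha`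
(B1 ⟸ B1-level ∧ B1-sha modulo MW Thm. 2, GZK, Cassels, modularity; p677037) with its Stub C slot fed by `stubC_of_heegnerFamily_bernoulliUnit_six`.
So the crux's research residue on this line reads with NO character and NO Bernoulli number on the arithmetic side — «`BSD_p` for the rank-one
members whose generator is `p`-divisible in `W(ℚ_p)`» (B1-level) and «`BSD_p` for the rank-one members with `Ш(W/ℚ)[p] ≠ 0`» (B1-sha) — and with
NO curve on the analytic side — `(P⁶_fam)`: for `p ∈ {7,11,19,43,67,163}`, `m ⊥ p`, `χ` primitive quadratic mod `m`, the sign-determined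
`k ∈ {(p+1)/4,(3p−1)/4}` (unit class factor available): some `n ∈ pm·ℤ`, `t` prime to `2pm`, `t² < 4n`, a quadratic `K` with `d_K·F² = t² − 4n`,
`d_K ≠ −3`, a Kronecker `ε_K`, and `p ∤ B_{k,(χ·ε_K)~}/k`. Conditional on the named facts it lists (incl. Mazur–Wiles Thm. 2, used only for the
B1 ⟸ B1-level ∧ B1-sha direction); BSD is not proved by any of this. [cite: KrizLi2019, Thm. 1.20 (pp. 7–8) and §8 (pp. 49–52)]
[cite: MazurWiles1984, Thm. 2 (p. 214)] [cite: Cox2013, §7.A (7.2)–(7.3) and Prop. 5.16] -/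
theorem bottomClassIndexLawFiveLe_of_prints4_of_mazurWiles_of_krizLi_of_heegnerFamily_six_of_level_of_sha
    (hprints4 :
    Hsieh2014.thmA_exists_isHsiehLFunction_unrPeriod_anyLevel ∧
    LiuZhangZhang2018.thm151_thm153_modularCurve_heegnerVector_additive ∧
    Summit.BirchSwinnertonDyer.BirchSwinnertonDyer.Theses.UniversalToricDescent.ToricPublishedInputs ∧
    bsdTriple_of_hasCM_of_L_one_ne_zero)
    (hMW : Literature.NumberTheory.NumberFields.MazurWiles1984.thm2_card_oddChiClassGroup_eq_bernoulli)
    (hKL : KrizLi2019.thm120_padicLogHeegner_unit_of_bernoulli)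
    (hF : ∀ (p : ℕ) [Fact p.Prime] (m : ℕ) [NeZero m] (χ : DirichletCharacter ℚ_[p] m) (k : ℕ),
      (p = 7 ∨ p = 11 ∨ p = 19 ∨ p = 43 ∨ p = 67 ∨ p = 163) →
      m.Coprime p → χ.IsPrimitive → χ.IsQuadratic → (k = (p + 1) / 4 ∨ k = (3 * p - 1) / 4) →
      2 ≤ k → k ≤ p - 2 → χ (-1) * (-1) ^ k = -1 →
      ¬ ‖((p - k : ℕ) : ℚ_[p])⁻¹ * generalizedBernoulli (p - k) χ‖ ≤ (p : ℝ)⁻¹ →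
      ∃ (n t F : ℤ) (K : Type) (_ : Field K) (_ : NumberField K)
        (εK : DirichletCharacter ℚ_[p] (NumberField.discr K).natAbs),
        Module.finrank ℚ K = 2 ∧ NumberField.discr K * F ^ 2 = t ^ 2 - 4 * n ∧ t ^ 2 < 4 * n ∧
        ((p * m : ℕ) : ℤ) ∣ n ∧ IsCoprime t ((2 * p * m : ℕ) : ℤ) ∧ NumberField.discr K ≠ -3 ∧
        IsKroneckerCharacterOf K εK ∧
        ¬ ‖(k : ℚ_[p])⁻¹ * @generalizedBernoulli ℚ_[p] _ _
            (changeLevel (dvd_mul_right m (NumberField.discr K).natAbs) χ *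
              changeLevel (dvd_mul_left (NumberField.discr K).natAbs m) εK).conductor ⟨conductor_ne_zero _⟩ k
            (changeLevel (dvd_mul_right m (NumberField.discr K).natAbs) χ *
              changeLevel (dvd_mul_left (NumberField.discr K).natAbs m) εK).primitiveCharacter‖ ≤ (p : ℝ)⁻¹)
    (hLevel :
    ∀ (W : WeierstrassCurve ℚ) [W.IsElliptic] [W.IsGloballyMinimal] (p : ℕ) [Fact p.Prime],
      W.HasCM → CMRamified W p → 5 ≤ p → W.analyticRank = 1 →
      ∀ P : W.toAffine.Point, ¬ IsOfFinAddOrder P →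
        (∀ R : W.toAffine.Point, ∃ (k : ℤ) (T : W.toAffine.Point), IsOfFinAddOrder T ∧ R = k • P + T) →
        (∃ Q : (W.baseChange ℚ_[p]).toAffine.Point, p • Q = W.toPadicPoint p P) →
        BSDp W p)
    (hSha :
    ∀ (W : WeierstrassCurve ℚ) [W.IsElliptic] [W.IsGloballyMinimal] (p : ℕ) [Fact p.Prime],
      W.HasCM → CMRamified W p → 5 ≤ p → W.analyticRank = 1 →
      (∃ s ∈ W.sha, s ≠ 0 ∧ p • s = 0) → BSDp W p) :
    Summit.BirchSwinnertonDyer.BirchSwinnertonDyer.Theses.PrintCFram.BottomClassIndexLawFiveLe :=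
  EisensteinEndStateV19Binders.bottomClassIndexLawFiveLe_of_prints4_of_mazurWiles_of_krizLi_of_cover_of_level_of_sha hprints4 hMW hKL
    (stubC_of_heegnerFamily_bernoulliUnit_six hF) hLevel hSha

end Summit.BirchSwinnertonDyer.BirchSwinnertonDyer.Theorems.PrintCFram.HeegnerFieldSupply

end
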